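import Summits.QuantumFields.YangMills.Theses.ParabolicTrajectory
import Literature.Probability.LatticeModels.GibbsSpecification
import Literature.MathematicalPhysics.QuantumFieldTheory.YangMillsOS
import Mathlib.Probability.Moments.Covariance
import Summits.QuantumFields.YangMills.Theorems.ParabolicTrajectoryLatticeGapOnTrajectoryDefs

/-!
# Route `ParabolicTrajectory`, crux `LatticeGapOnTrajectory` (stmt-QuantumFields-10523),
# line `orbit-kantorovich-finite-size`: stub `stub_torusFrames`

Proof of `TorusFramesExist` (the statement consumed by `stub_smoothingToGap`), pure `ZMod`
combinatorics:

* Clause (1): for every torus frame `q : ZMod N → ZMod (μ+1)` of scale `b` (a `0/1`-step label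
  map whose fibres are cyclic arcs of length in `[b, 2b]`) the cyclic site distance is controlled
  by the cyclic label distance, `|y − x| ≤ 2b (|q y − q x| + 1)`. Walk from `x` to `y` and back
  round the cycle counting label increments (`inc`): the `n + 1` sites of a walk of `n < N` steps
  with `k` increments lie in `k + 1` fibres of `≤ 2b` sites each, and the increments of the two
  complementary walks add up to a multiple of `μ + 1` that is at most `μ + 1` (label maps are
  injective on arc right-endpoints).
* Clause (2): for `(2n₀+3)·2b ≤ N`, `4w + 4 ≤ b` and centres `x₁, x₂` (swapped so that
  `(x₂ - x₁).val ≤ N/2`), the uniform frame `z ↦ min ((z - o).val / b) K`, `K + 1 = N / b`, with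
  origin `o = x₁ - w - v` and a slide `v ≤ 2w` making `((x₂ - x₁).val + v) % b + 2w < b`, has
  `≥ 2n₀ + 3` cells of length `b` (the last one of length `b + N % b`) and keeps both arcs
  `xᵢ - w, …, xᵢ + w` inside one cell.
-/

/-! Part ONE of two (≤ 400-line split): the walk/increment bookkeeping and `part_one` (coarse-Lipschitz control for ANY frame);
`part_two` and the registered stub are in `…StubTorusFrames.lean`, which imports this file. -/

namespace Summit.QuantumFields.YangMills.Cruxes.LatticeGapOnTrajectory.OrbitKantorovichFiniteSize
open scoped BigOperators Topology ENNReal ProbabilityTheory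
open Filter MeasureTheory
open Literature.Probability.LatticeModels (Specification IsSpecification IsGibbsMeasure glueWith)
open Literature.MathematicalPhysics.QuantumFieldTheory
noncomputable section

namespace StubTorusFrames

/-! ### Part (1): coarse-Lipschitz control of the site distance by the label distance, for ANY frame

For a walk `x, x+1, …, x+n` let `inc q x n` be the number of label increments along it. Then
`q (x + n) = q x + inc q x n`; the `n + 1` visited sites (distinct when `n < N`) lie in the
`inc + 1` fibres `q x, …, q x + inc`, each of cardinality `≤ 2b`, so `n + 1 ≤ 2b (inc + 1)`; and
the increments of the two complementary walks `x → y`, `y → x` add up to the number of fibre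
right-endpoints, which is `≤ m` and `≡ 0 (mod m)`, hence `0` or `m`. -/

variable {N m : ℕ}

/-- Number of label increments of `q` along the walk `x, x + 1, …, x + n`. -/
def inc (q : ZMod N → ZMod m) (x : ZMod N) : ℕ → ℕ
  | 0 => 0
  | n + 1 => inc q x n + if q (x + n + 1) = q (x + n) then 0 else 1

/-- `inc` at `0`. -/
@[simp] theorem inc_zero (q : ZMod N → ZMod m) (x : ZMod N) : inc q x 0 = 0 := rfl

/-- `inc` at a successor. -/
theorem inc_succ (q : ZMod N → ZMod m) (x : ZMod N) (n : ℕ) :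
    inc q x (n + 1) = inc q x n + if q (x + n + 1) = q (x + n) then 0 else 1 := rfl

/-- Along a walk of a `0/1`-step label map the label advances by the number of increments. -/
theorem apply_add_nat (q : ZMod N → ZMod m) (hstep : ∀ x, q (x + 1) = q x ∨ q (x + 1) = q x + 1)
    (x : ZMod N) (n : ℕ) : q (x + n) = q x + inc q x n := by
  induction n with
  | zero => simp
  | succ n ih =>
    rw [inc_succ, Nat.cast_succ, ← add_assoc]
    by_cases hc : q (x + n + 1) = q (x + n)
    · rw [if_pos hc, hc, ih, add_zero]
    · rw [if_neg hc]
      rcases hstep (x + n) with h | h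
      · exact absurd h hc
      · rw [h, ih]; push_cast; ring

/-- `inc` is monotone in the number of steps. -/
theorem inc_mono (q : ZMod N → ZMod m) (x : ZMod N) : Monotone (inc q x) :=
  monotone_nat_of_le_succ fun n => by rw [inc_succ]; exact Nat.le_add_right _ _

/-- `inc` is additive along concatenated walks. -/
theorem inc_add (q : ZMod N → ZMod m) (x : ZMod N) (n k : ℕ) :
    inc q x (n + k) = inc q x n + inc q (x + n) k := by
  induction k with
  | zero => simp
  | succ k ih => simp only [← add_assoc, inc_succ, ih, Nat.cast_add]

/-- `inc` counts the increment positions. -/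
theorem inc_eq_card (q : ZMod N → ZMod m) (x : ZMod N) (n : ℕ) :
    inc q x n = ((Finset.range n).filter fun i : ℕ => q (x + i + 1) ≠ q (x + i)).card := by
  induction n with
  | zero => simp
  | succ n ih =>
    rw [inc_succ, ih, Finset.range_add_one, Finset.filter_insert]
    by_cases hc : q (x + n + 1) = q (x + n)
    · simp [hc]
    · simp [hc]

/-- A fibre described as an arc `{a + j | j < ℓ}` has at most `ℓ` sites. -/
theorem card_fibre_le [NeZero N] (q : ZMod N → ZMod m) (c : ZMod m) (a : ZMod N) (ℓ : ℕ)
    (hiff : ∀ z : ZMod N, q z = c ↔ ∃ j : ℕ, j < ℓ ∧ z = a + j) :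
    (Finset.univ.filter fun z => q z = c).card ≤ ℓ := by
  calc (Finset.univ.filter fun z => q z = c).card
      ≤ ((Finset.range ℓ).image fun j : ℕ => a + (j : ZMod N)).card := by
        apply Finset.card_le_card
        intro z hz
        rw [Finset.mem_filter] at hz
        obtain ⟨j, hj, rfl⟩ := (hiff z).mp hz.2
        exact Finset.mem_image.mpr ⟨j, Finset.mem_range.mpr hj, rfl⟩
    _ ≤ (Finset.range ℓ).card := Finset.card_image_le
    _ = ℓ := Finset.card_range ℓ

/-- Going once round the cycle, the number of increments is at most the number of labels: an
increment position with label `c` is the right endpoint of the arc `q ⁻¹ {c}`, and `q` is injective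
on these. -/
theorem inc_le_card [NeZero N] [NeZero m] (q : ZMod N → ZMod m)
    (hfib : ∀ c : ZMod m, ∃ (a : ZMod N) (ℓ : ℕ),
      ∀ z : ZMod N, q z = c ↔ ∃ j : ℕ, j < ℓ ∧ z = a + j)
    (x : ZMod N) : inc q x N ≤ m := by
  rw [inc_eq_card]
  calc ((Finset.range N).filter fun i : ℕ => q (x + i + 1) ≠ q (x + i)).card
      ≤ (Finset.univ : Finset (ZMod m)).card := by
        refine Finset.card_le_card_of_injOn (fun i : ℕ => q (x + i))
          (fun i _ => Finset.mem_coe.mpr (Finset.mem_univ _)) ?_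
        intro i hi i' hi' h
        rw [Finset.mem_coe, Finset.mem_filter, Finset.mem_range] at hi hi'
        have h : q (x + i) = q (x + i') := h
        obtain ⟨a, ℓ, hiff⟩ := hfib (q (x + i))
        -- an increment position with label `q (x + i)` is the right endpoint of the arc
        have key : ∀ i₀ : ℕ, q (x + i₀ + 1) ≠ q (x + i₀) → q (x + i₀) = q (x + i) →
            (x : ZMod N) + i₀ = a + ((ℓ - 1 : ℕ) : ZMod N) := by
          intro i₀ hne heq
          obtain ⟨j, hj, hxj⟩ := (hiff (x + i₀)).mp heq
          have hjl : ℓ ≤ j + 1 := by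
            by_contra! hlt
            apply hne
            rw [heq]
            exact (hiff _).mpr ⟨j + 1, hlt, by rw [hxj]; push_cast; ring⟩
          rw [hxj, show j = ℓ - 1 by omega]
        have h1 := key i hi.2 rfl
        have h2 := key i' hi'.2 h.symm
        have hii' : ((i : ℕ) : ZMod N) = (i' : ZMod N) := add_left_cancel (h1.trans h2.symm)
        rw [ZMod.natCast_eq_natCast_iff', Nat.mod_eq_of_lt hi.1, Nat.mod_eq_of_lt hi'.1] at hii'
        exact hii'
    _ = m := by rw [Finset.card_univ, ZMod.card]

/-- The walk bound: `n + 1` distinct sites in `inc + 1` fibres of cardinality `≤ 2b`. -/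
theorem walk_bound [NeZero N] {b : ℕ} (q : ZMod N → ZMod m)
    (hstep : ∀ x, q (x + 1) = q x ∨ q (x + 1) = q x + 1)
    (hfib : ∀ c : ZMod m, ∃ (a : ZMod N) (ℓ : ℕ), b ≤ ℓ ∧ ℓ ≤ 2 * b ∧
      ∀ z : ZMod N, q z = c ↔ ∃ j : ℕ, j < ℓ ∧ z = a + j)
    (x : ZMod N) {n : ℕ} (hn : n < N) : n + 1 ≤ 2 * b * (inc q x n + 1) := by
  set k := inc q x n with hk
  set S : Finset (ZMod N) := (Finset.range (n + 1)).image fun i : ℕ => x + (i : ZMod N) with hS_def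
  have hS : S.card = n + 1 := by
    rw [hS_def, Finset.card_image_of_injOn, Finset.card_range]
    intro i hi i' hi' h
    rw [Finset.coe_range, Set.mem_Iio] at hi hi'
    have h : (x : ZMod N) + i = x + i' := h
    have hii' := add_left_cancel h
    rwa [ZMod.natCast_eq_natCast_iff', Nat.mod_eq_of_lt (by omega), Nat.mod_eq_of_lt (by omega)]
      at hii'
  set T : Finset (ZMod N) := (Finset.range (k + 1)).biUnion fun j : ℕ =>
    Finset.univ.filter fun z => q z = q x + (j : ZMod m) with hT_def
  have hST : S ⊆ T := by
    intro z hz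
    rw [hS_def, Finset.mem_image] at hz
    obtain ⟨i, hi, rfl⟩ := hz
    rw [Finset.mem_range] at hi
    rw [hT_def, Finset.mem_biUnion]
    refine ⟨inc q x i, Finset.mem_range.mpr ?_, ?_⟩
    · exact Nat.lt_succ_of_le (inc_mono q x (Nat.le_of_lt_succ hi))
    · rw [Finset.mem_filter]
      exact ⟨Finset.mem_univ _, apply_add_nat q hstep x i⟩
  have hT : T.card ≤ (k + 1) * (2 * b) := by
    calc T.card
        ≤ ∑ j ∈ Finset.range (k + 1),
            (Finset.univ.filter fun z => q z = q x + (j : ZMod m)).card := Finset.card_biUnion_le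
      _ ≤ ∑ _j ∈ Finset.range (k + 1), 2 * b := by
          apply Finset.sum_le_sum
          intro j _
          obtain ⟨a, ℓ, -, hℓ, hiff⟩ := hfib (q x + (j : ZMod m))
          exact (card_fibre_le q _ a ℓ hiff).trans hℓ
      _ = (k + 1) * (2 * b) := by rw [Finset.sum_const, Finset.card_range, smul_eq_mul]
  calc n + 1 = S.card := hS.symm
    _ ≤ T.card := Finset.card_le_card hST
    _ ≤ (k + 1) * (2 * b) := hT
    _ = 2 * b * (k + 1) := by ring

/-- **Clause (1)**: for every torus frame of scale `b`, `|y − x| ≤ 2b (|q y − q x| + 1)`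
(cyclic distances). -/
theorem part_one (N b μ : ℕ) (q : ZMod N → ZMod (μ + 1)) [NeZero N]
    (hq : IsTorusFrame N b q) (x y : ZMod N) :
    ((y - x).valMinAbs).natAbs ≤ 2 * b * ((((q y - q x).valMinAbs).natAbs) + 1) := by
  obtain ⟨hstep, hfib⟩ := hq
  rw [ZMod.valMinAbs_natAbs_eq_min (y - x)]
  set n := (y - x).val with hn
  have hnN : n < N := ZMod.val_lt _
  have hy : y = x + (n : ZMod N) := by rw [hn, ZMod.natCast_zmod_val]; ring
  have hyx : y + ((N - n : ℕ) : ZMod N) = x := by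
    rw [hy, Nat.cast_sub hnN.le, ZMod.natCast_self]; ring
  set k := inc q x n with hk
  set k' := inc q y (N - n) with hk'
  have hqy : q y = q x + (k : ZMod (μ + 1)) := by rw [hy]; exact apply_add_nat q hstep x n
  have hqx : q x = q y + (k' : ZMod (μ + 1)) := by
    have := apply_add_nat q hstep y (N - n); rwa [hyx] at this
  have hkk' : k + k' = inc q x N := by
    have := inc_add q x n (N - n)
    rw [Nat.add_sub_cancel' hnN.le, ← hy] at this
    exact this.symm
  have hle : k + k' ≤ μ + 1 := by
    rw [hkk']
    exact inc_le_card q (fun c => let ⟨a, ℓ, _, _, h⟩ := hfib c; ⟨a, ℓ, h⟩) x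
  have hdvd : (μ + 1) ∣ (k + k') := by
    rw [← ZMod.natCast_eq_zero_iff]
    have : q x + ((k + k' : ℕ) : ZMod (μ + 1)) = q x + 0 := by
      rw [add_zero, Nat.cast_add, ← add_assoc, ← hqy, ← hqx]
    exact add_left_cancel this
  have hb1 : n + 1 ≤ 2 * b * (k + 1) := walk_bound q hstep hfib x hnN
  by_cases hkm : 2 * k ≤ μ + 1
  · have hd : ((q y - q x).valMinAbs).natAbs = k := by
      rw [hqy, add_sub_cancel_left, ZMod.valMinAbs_natCast_of_le_half (by omega),
        Int.natAbs_natCast]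
    rw [hd]
    calc min n (N - n) ≤ n := min_le_left _ _
      _ ≤ 2 * b * (k + 1) := by omega
  · rw [not_le] at hkm
    have hnpos : 0 < n := by
      rcases Nat.eq_zero_or_pos n with h0 | h0
      · exfalso
        have : k = 0 := by rw [hk, h0, inc_zero]
        omega
      · exact h0
    have heq : k + k' = μ + 1 := by
      rcases Nat.eq_zero_or_pos (k + k') with h0 | hpos
      · omega
      · exact le_antisymm hle (Nat.le_of_dvd hpos hdvd)
    have hb2 : N - n + 1 ≤ 2 * b * (k' + 1) := walk_bound q hstep hfib y (by omega)
    have hd : ((q y - q x).valMinAbs).natAbs = k' := by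
      have : q y - q x = -((k' : ℕ) : ZMod (μ + 1)) := by rw [hqx]; ring
      rw [this, ZMod.natAbs_valMinAbs_neg, ZMod.valMinAbs_natCast_of_le_half (by omega),
        Int.natAbs_natCast]
    rw [hd]
    calc min n (N - n) ≤ N - n := min_le_right _ _
      _ ≤ 2 * b * (k' + 1) := by omega


end StubTorusFrames

end

end Summit.QuantumFields.YangMills.Cruxes.LatticeGapOnTrajectory.OrbitKantorovichFiniteSize
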